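import Summits.ValiantsHypothesis.ValiantsHypothesis.Theorems.BarrierLeverChowHitsPartitionMinorsRStarvedPivots

/-!
# Route BarrierLever — item `ChowHitsPartitionMinorsR` (stmt-ValiantsHypothesis-21882), STARVED DESIGN VI:
# the row-reduced polynomials, the rank-triangular criterion and THE CANCELLATION at the triangle columns

Helper file (`--supports stmt-ValiantsHypothesis-21882`; cell valiant-natproofs, rung V4, 𝒟-side; prover seat val-np-p5
gen 31). Closes NO item. Sixth file of the kernel chain for THEOREM A′ of memo MEMO-21882-valnp5-g31.md §3/§5 (K-A3b-3);
the assembly (pivot bijection, rank dispatch, span transfer) is the sequel `…RStarvedTheoremA`.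

**THEOREM A′** (target of the chain). Rows: ALL subsets of `Fin h` of size `≤ 2` (`u` injective onto them). Columns: an
injective face-closed family `w` of sets of size `≤ 3` containing every singleton, STARVED with respect to a set `O`:
every 3-column avoids `O`, and the non-edges (pairs that are not columns) are matched bijectively (`α j, β j ∈ O`) with
the 3-columns `j`. Then the product of the `h + #3-columns` forms `1 + x_a + y_a` (`a : Fin h`) and
`1 + (x_{α j} + x_{β j}) + Σ_{c ∈ w j} y_c` (`j` a 3-column) has nonzero partition minor on `(u, w)`.

Proof (memo §3): by the normal form (p724767) it suffices that the `ρ̂`-matrix `N[i,k] = coeff_{w k} rowPoly (u i)` is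
nonsingular; the explicit row-reduced polynomials `pPoly U` defined HERE (constant-stripped vertex rows `rr`, products
`rr a · rr b` for edge pairs, and for a matched non-edge `{α j, β j}` the product corrected by
`corrNE j = −(2 qq j + qq j²) − Σ_t inc β {t} rr t rr α − Σ_t inc α {t} rr t rr β`) lie in the span of the rows of `N`, and their
coefficient matrix is RANK-TRIANGULAR (rows ∅ < O-singletons < O–O edges < mixed edges < non-edges < K-singletons <
K–K edges; pivots ∅, y_a, y^{ab}, y^{ta}, y^{w j} (coefficient 24), y_t, y^{tt'}); the criterion is
`det_ne_zero_of_rankTriangular` (this file). THIS FILE proves the product tables of `rr`, `qq` at exponents of size `2, 3`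
(`coeff_rr_mul_rr_two/three`, `coeff_qq_mul_qq_two/three`, `coeff_pivotTerm`) and **THE EXACT CANCELLATION of memo §3 STEP 3:
`coeff_pNE_triple` — at every 3-column `w j'` the non-edge row of `j` has coefficient `24·[j' = j]`** (the cross terms
`Λ_a Q_b + Λ_b Q_a` are cancelled by the `inc`-weighted mixed rows).

WHAT THIS IS NOT: the item (all layouts) is not closed; nothing on crux stmt-ValiantsHypothesis-14610 or on `VP` versus `VNP`.
-/

set_option linter.dupNamespace false

namespace Summit.ValiantsHypothesis.ValiantsHypothesis.Theorems.BarrierLever.ChowStarvedDesign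

open Finset MvPolynomial
open Summit.ValiantsHypothesis.ValiantsHypothesis.Theorems.BarrierLever.ChowStarve
  (coeff_mul_of_noConst_card_le_one coeff_mul_of_noConst_card_two coeff_mul_of_noConst_card_three)

noncomputable section

variable {h r : ℕ}

/-! ## 1. A rank-triangular determinant criterion -/

/-- A square matrix is nonsingular if, for a permutation `σ` and a rank function `rk`, every nonzero entry `M k j` has
`k = σ j` or `rk k < rk (σ j)` (strictly above the pivot in rank), and the pivot entries `M (σ j) j` are nonzero. -/
theorem det_ne_zero_of_rankTriangular {K : Type*} [Field K] {r : ℕ} (rk : Fin r → ℕ) (N : ℕ) (hN : ∀ k, rk k ≤ N)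
    (σ : Equiv.Perm (Fin r)) (M : Matrix (Fin r) (Fin r) K)
    (hM : ∀ k j, M k j ≠ 0 → k = σ j ∨ rk k < rk (σ j)) (hdiag : ∀ j, M (σ j) j ≠ 0) : M.det ≠ 0 := by
  classical
  have hinj : Function.Injective fun v => Matrix.mulVec M v := by
    intro c₁ c₂ hc
    rw [← sub_eq_zero]
    set c := c₁ - c₂ with hcdef
    have h0 : ∀ k, ∑ j, M k j * c j = 0 := by
      intro k
      have e' := congr_fun hc k
      simp only [Matrix.mulVec, dotProduct] at e'
      simp only [hcdef, Pi.sub_apply, mul_sub, Finset.sum_sub_distrib]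
      exact sub_eq_zero.mpr e'
    -- induction on `rk (σ j)`, largest ranks first
    have hind : ∀ n : ℕ, ∀ j, N - rk (σ j) = n → c j = 0 := by
      intro n
      induction n using Nat.strong_induction_on with
      | _ n ih =>
        intro j hn
        have hsum := h0 (σ j)
        rw [← Finset.add_sum_erase _ _ (Finset.mem_univ j)] at hsum
        have hrest : ∑ j' ∈ (Finset.univ : Finset (Fin r)).erase j, M (σ j) j' * c j' = 0 := by
          refine Finset.sum_eq_zero fun j' hj' => ?_
          have hne : j' ≠ j := (Finset.mem_erase.mp hj').1
          by_cases hz : M (σ j) j' = 0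
          · rw [hz, zero_mul]
          · rcases hM (σ j) j' hz with e | hlt
            · exact absurd (σ.injective e).symm hne
            · have := hN (σ j')
              rw [ih (N - rk (σ j')) (by omega) j' rfl, mul_zero]
        rw [hrest, add_zero] at hsum
        exact (mul_eq_zero.mp hsum).resolve_left (hdiag j)
    funext j
    exact hind _ j rfl
  have hu' := Matrix.mulVec_injective_iff_isUnit.mp hinj
  exact ((Matrix.isUnit_iff_isUnit_det _).mp hu').ne_zero

/-! ## 2. The row-reduced polynomials of the starved design -/

section Design

variable (w : Fin r → Finset (Fin h)) (α β : {j : Fin r // (w j).card = 3} → Fin h)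

/-- The non-edge correction of the 3-column `j`: `−(2 qq j + qq j²) − Σ_t inc β {t} · rr t rr α − Σ_t inc α {t} · rr t rr β`. -/
def corrNE (j : {j : Fin r // (w j).card = 3}) : MvPolynomial (Fin (h + h)) ℂ :=
  -(2 * qq w j + qq w j * qq w j) -
    ∑ t, C (inc w α β (β j) {t} : ℂ) * (rr w α β t * rr w α β (α j)) -
    ∑ t, C (inc w α β (α j) {t} : ℂ) * (rr w α β t * rr w α β (β j))

/-- The row-reduced polynomial of a row `U` (`|U| ≤ 2`). -/
def pPoly (U : Finset (Fin h)) : MvPolynomial (Fin (h + h)) ℂ :=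
  if U.card = 0 then 1 else if U.card = 1 then ∑ v ∈ U, rr w α β v
  else C (1 / 2 : ℂ) * (∑ a ∈ U, ∑ b ∈ U.erase a, rr w α β a * rr w α β b) +
    ∑ j ∈ Finset.univ.filter (fun j : {j : Fin r // (w j).card = 3} => ({α j, β j} : Finset (Fin h)) = U), corrNE w α β j

/-- `pPoly ∅ = 1`. -/
theorem pPoly_empty : pPoly w α β (∅ : Finset (Fin h)) = 1 := by simp [pPoly]

/-- `pPoly {v} = rr v`. -/
theorem pPoly_singleton (v : Fin h) : pPoly w α β ({v} : Finset (Fin h)) = rr w α β v := by simp [pPoly]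

/-- `pPoly {a,b} = rr a · rr b + Σ_{j : {α j, β j} = {a,b}} corrNE j` (`a ≠ b`). -/
theorem pPoly_pair (a b : Fin h) (hab : a ≠ b) :
    pPoly w α β ({a, b} : Finset (Fin h)) = rr w α β a * rr w α β b +
      ∑ j ∈ Finset.univ.filter (fun j : {j : Fin r // (w j).card = 3} => ({α j, β j} : Finset (Fin h)) = {a, b}),
        corrNE w α β j := by
  unfold pPoly
  rw [if_neg (by rw [Finset.card_pair hab]; norm_num), if_neg (by rw [Finset.card_pair hab]; norm_num),
    Finset.sum_pair hab, Finset.erase_insert (Finset.notMem_singleton.mpr hab), Finset.sum_singleton,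
    Finset.erase_insert_of_ne hab, Finset.erase_singleton, Finset.insert_empty, Finset.sum_singleton,
    mul_comm (rr w α β b)]
  congr 1
  calc C (1 / 2 : ℂ) * (rr w α β a * rr w α β b + rr w α β a * rr w α β b)
      = ((2 : MvPolynomial (Fin (h + h)) ℂ) * C (1 / 2 : ℂ)) * (rr w α β a * rr w α β b) := by ring
    _ = rr w α β a * rr w α β b := by
        rw [show (2 : MvPolynomial (Fin (h + h)) ℂ) = C 2 from (map_ofNat C 2).symm, ← C_mul]
        norm_num

end Design

/-! ## 3. Product tables of the reduced polynomials -/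

section Products

variable (w : Fin r → Finset (Fin h)) (α β : {j : Fin r // (w j).card = 3} → Fin h)

/-- Products of reduced vertex polynomials vanish at exponents of size `≤ 1`. -/
theorem coeff_rr_mul_rr_le_one (x y : Fin h) (W : Finset (Fin h)) (hW : W.card ≤ 1) :
    coeff (∑ a' ∈ (∅ : Finset (Fin h)), Finsupp.single (Fin.castAdd h a') 1 +
        ∑ c ∈ W, Finsupp.single (Fin.natAdd h c) 1) (rr w α β x * rr w α β y) = 0 :=
  coeff_mul_of_noConst_card_le_one _ _ (yOnly_rr w α β y) (coeff_rr_empty w α β x) (coeff_rr_empty w α β y) W hW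

/-- **Pair table**: `coeff (E ∅ W) (rr x · rr y) = Σ_{c∈W} ([W∖c = {x}] + inc x (W∖c)) ([c = y] + inc y {c})` (`|W| = 2`). -/
theorem coeff_rr_mul_rr_two (x y : Fin h) (W : Finset (Fin h)) (hW : W.card = 2) :
    coeff (∑ a' ∈ (∅ : Finset (Fin h)), Finsupp.single (Fin.castAdd h a') 1 +
        ∑ c ∈ W, Finsupp.single (Fin.natAdd h c) 1) (rr w α β x * rr w α β y) =
      ∑ c ∈ W, ((if W.erase c = {x} then 1 else 0) + (inc w α β x (W.erase c) : ℂ)) *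
        ((if c = y then 1 else 0) + (inc w α β y {c} : ℂ)) := by
  rw [coeff_mul_of_noConst_card_two _ _ (yOnly_rr w α β y) (coeff_rr_empty w α β x) (coeff_rr_empty w α β y) W hW]
  refine Finset.sum_congr rfl fun c hc => ?_
  have hc1 : (W.erase c).card ≤ 3 := by rw [Finset.card_erase_of_mem hc]; omega
  rw [coeff_rr w α β x (W.erase c) hc1, if_neg (by
      intro h0; have := Finset.card_erase_of_mem hc; rw [h0, Finset.card_empty] at this; omega),
    Finset.card_erase_of_mem hc, hW, coeff_rr_single]
  norm_num
  ring

/-- **Triple table**: `coeff (E ∅ W) (rr x · rr y) =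
Σ_{c∈W} (2 inc x (W∖c) · (−([c=y] + inc y {c})) + (−([c=x] + inc x {c})) · 2 inc y (W∖c))` (`|W| = 3`). -/
theorem coeff_rr_mul_rr_three (x y : Fin h) (W : Finset (Fin h)) (hW : W.card = 3) :
    coeff (∑ a' ∈ (∅ : Finset (Fin h)), Finsupp.single (Fin.castAdd h a') 1 +
        ∑ c ∈ W, Finsupp.single (Fin.natAdd h c) 1) (rr w α β x * rr w α β y) =
      ∑ c ∈ W, (2 * (inc w α β x (W.erase c) : ℂ) * -((if c = y then 1 else 0) + (inc w α β y {c} : ℂ)) +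
        -((if c = x then 1 else 0) + (inc w α β x {c} : ℂ)) * (2 * (inc w α β y (W.erase c) : ℂ))) := by
  rw [coeff_mul_of_noConst_card_three _ _ (yOnly_rr w α β y) (coeff_rr_empty w α β x) (coeff_rr_empty w α β y) W hW]
  refine Finset.sum_congr rfl fun c hc => ?_
  have hc2 : (W.erase c).card = 2 := by rw [Finset.card_erase_of_mem hc]; omega
  rw [coeff_rr_two w α β x (W.erase c) hc2, coeff_rr_two w α β y (W.erase c) hc2, coeff_rr_single, coeff_rr_single]

/-- Products `qq j · qq j` vanish at exponents of size `≤ 1`. -/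
theorem coeff_qq_mul_qq_le_one (j : {j : Fin r // (w j).card = 3}) (W : Finset (Fin h)) (hW : W.card ≤ 1) :
    coeff (∑ a' ∈ (∅ : Finset (Fin h)), Finsupp.single (Fin.castAdd h a') 1 +
        ∑ c ∈ W, Finsupp.single (Fin.natAdd h c) 1) (qq w j * qq w j) = 0 :=
  coeff_mul_of_noConst_card_le_one _ _ (yOnly_qq w j) (coeff_qq_empty w j) (coeff_qq_empty w j) W hW

/-- `coeff (E ∅ W) (qq j · qq j) = 2 [W ⊆ w j]` for `|W| = 2`. -/
theorem coeff_qq_mul_qq_two (j : {j : Fin r // (w j).card = 3}) (W : Finset (Fin h)) (hW : W.card = 2) :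
    coeff (∑ a' ∈ (∅ : Finset (Fin h)), Finsupp.single (Fin.castAdd h a') 1 +
        ∑ c ∈ W, Finsupp.single (Fin.natAdd h c) 1) (qq w j * qq w j) = 2 * (if W ⊆ w j.1 then 1 else 0 : ℂ) := by
  rw [coeff_mul_of_noConst_card_two _ _ (yOnly_qq w j) (coeff_qq_empty w j) (coeff_qq_empty w j) W hW]
  have hterm : ∀ c ∈ W, coeff (∑ a' ∈ (∅ : Finset (Fin h)), Finsupp.single (Fin.castAdd h a') 1 +
        ∑ c' ∈ W.erase c, Finsupp.single (Fin.natAdd h c') 1) (qq w j) *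
      coeff (∑ a' ∈ (∅ : Finset (Fin h)), Finsupp.single (Fin.castAdd h a') 1 +
        ∑ c' ∈ ({c} : Finset (Fin h)), Finsupp.single (Fin.natAdd h c') 1) (qq w j) =
      (if W ⊆ w j.1 then 1 else 0 : ℂ) := by
    intro c hc
    have hc1 : (W.erase c).card ≤ 3 := by rw [Finset.card_erase_of_mem hc]; omega
    rw [coeff_qq w j (W.erase c) hc1, if_neg (by
        intro h0; have := Finset.card_erase_of_mem hc; rw [h0, Finset.card_empty] at this; omega),
      Finset.card_erase_of_mem hc, hW, coeff_qq_single]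
    by_cases hWj : W ⊆ w j.1
    · rw [if_pos hWj, if_pos ((Finset.erase_subset c W).trans hWj), if_pos (hWj hc)]; norm_num
    · rw [if_neg hWj]
      by_cases hc' : c ∈ w j.1
      · rw [if_neg (fun hsub => hWj (fun x hx => ?_))]
        · norm_num
        · by_cases hxc : x = c
          · rw [hxc]; exact hc'
          · exact hsub (Finset.mem_erase.mpr ⟨hxc, hx⟩)
      · rw [if_neg hc']; norm_num
  rw [Finset.sum_congr rfl hterm, Finset.sum_const, hW, nsmul_eq_mul, Nat.cast_ofNat]

/-- `coeff (E ∅ W) (qq j · qq j) = −12 [W ⊆ w j]` for `|W| = 3`. -/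
theorem coeff_qq_mul_qq_three (j : {j : Fin r // (w j).card = 3}) (W : Finset (Fin h)) (hW : W.card = 3) :
    coeff (∑ a' ∈ (∅ : Finset (Fin h)), Finsupp.single (Fin.castAdd h a') 1 +
        ∑ c ∈ W, Finsupp.single (Fin.natAdd h c) 1) (qq w j * qq w j) = -12 * (if W ⊆ w j.1 then 1 else 0 : ℂ) := by
  rw [coeff_mul_of_noConst_card_three _ _ (yOnly_qq w j) (coeff_qq_empty w j) (coeff_qq_empty w j) W hW]
  have hterm : ∀ c ∈ W, coeff (∑ a' ∈ (∅ : Finset (Fin h)), Finsupp.single (Fin.castAdd h a') 1 +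
        ∑ c' ∈ W.erase c, Finsupp.single (Fin.natAdd h c') 1) (qq w j) *
      coeff (∑ a' ∈ (∅ : Finset (Fin h)), Finsupp.single (Fin.castAdd h a') 1 +
        ∑ c' ∈ ({c} : Finset (Fin h)), Finsupp.single (Fin.natAdd h c') 1) (qq w j) +
      coeff (∑ a' ∈ (∅ : Finset (Fin h)), Finsupp.single (Fin.castAdd h a') 1 +
        ∑ c' ∈ ({c} : Finset (Fin h)), Finsupp.single (Fin.natAdd h c') 1) (qq w j) *
      coeff (∑ a' ∈ (∅ : Finset (Fin h)), Finsupp.single (Fin.castAdd h a') 1 +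
        ∑ c' ∈ W.erase c, Finsupp.single (Fin.natAdd h c') 1) (qq w j) =
      -4 * (if W ⊆ w j.1 then 1 else 0 : ℂ) := by
    intro c hc
    have hc2 : (W.erase c).card = 2 := by rw [Finset.card_erase_of_mem hc]; omega
    rw [coeff_qq_two w j (W.erase c) hc2, coeff_qq_single]
    by_cases hWj : W ⊆ w j.1
    · rw [if_pos hWj, if_pos ((Finset.erase_subset c W).trans hWj), if_pos (hWj hc)]; norm_num
    · rw [if_neg hWj]
      by_cases hc' : c ∈ w j.1
      · rw [if_neg (fun hsub => hWj (fun x hx => ?_))]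
        · norm_num
        · by_cases hxc : x = c
          · rw [hxc]; exact hc'
          · exact hsub (Finset.mem_erase.mpr ⟨hxc, hx⟩)
      · rw [if_neg hc']; norm_num
  rw [Finset.sum_congr rfl hterm, Finset.sum_const, hW, nsmul_eq_mul, Nat.cast_ofNat]
  norm_num

/-- **The pivot term**: `coeff (E ∅ W) (−(2 qq j + qq j²))` is `0, 2[c∈w j], −6[W ⊆ w j], 24[W ⊆ w j]` for `|W| = 0,1,2,3`. -/
theorem coeff_pivotTerm (j : {j : Fin r // (w j).card = 3}) (W : Finset (Fin h)) (hW : W.card ≤ 3) :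
    coeff (∑ a' ∈ (∅ : Finset (Fin h)), Finsupp.single (Fin.castAdd h a') 1 +
        ∑ c ∈ W, Finsupp.single (Fin.natAdd h c) 1) (-(2 * qq w j + qq w j * qq w j)) =
      if W = ∅ then 0 else
        (if W.card = 1 then (2 : ℂ) else if W.card = 2 then -6 else 24) * (if W ⊆ w j.1 then 1 else 0 : ℂ) := by
  rw [coeff_neg, coeff_add, show (2 : MvPolynomial (Fin (h + h)) ℂ) = C 2 from (map_ofNat C 2).symm, coeff_C_mul]
  by_cases hW0 : W = ∅
  · subst hW0
    rw [if_pos rfl, coeff_qq_empty, coeff_qq_mul_qq_le_one w j ∅ (by simp)]; norm_num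
  rw [if_neg hW0]
  have hpos : 0 < W.card := Finset.card_pos.mpr (Finset.nonempty_iff_ne_empty.mpr hW0)
  rcases Nat.lt_or_ge W.card 2 with h1 | h2
  · have hc1 : W.card = 1 := by omega
    obtain ⟨c, rfl⟩ := Finset.card_eq_one.mp hc1
    rw [coeff_qq_single, coeff_qq_mul_qq_le_one w j {c} (by simp), if_pos (Finset.card_singleton c)]
    by_cases hc : c ∈ w j.1
    · rw [if_pos (Finset.singleton_subset_iff.mpr hc), if_pos hc]; norm_num
    · rw [if_neg (fun hs => hc (Finset.singleton_subset_iff.mp hs)), if_neg hc]; norm_num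
  rcases Nat.lt_or_ge W.card 3 with h2' | h3
  · have hc2 : W.card = 2 := by omega
    rw [coeff_qq_two w j W hc2, coeff_qq_mul_qq_two w j W hc2, if_neg (show ¬ W.card = 1 by omega), if_pos hc2]
    split_ifs <;> norm_num
  · have hc3 : W.card = 3 := by omega
    rw [coeff_qq_three w j W hc3, coeff_qq_mul_qq_three w j W hc3, if_neg (show ¬ W.card = 1 by omega),
      if_neg (show ¬ W.card = 2 by omega)]
    split_ifs <;> norm_num

end Products

/-! ## 4. The starved hypotheses: vanishing of the incidence counts -/

section Starved

variable (w : Fin r → Finset (Fin h)) (O : Finset (Fin h)) (α β : {j : Fin r // (w j).card = 3} → Fin h)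
  (hα : ∀ j, α j ∈ O) (hβ : ∀ j, β j ∈ O) (hK : ∀ j : {j : Fin r // (w j).card = 3}, ∀ c ∈ w j.1, c ∉ O)
include hα hβ in
/-- A vertex outside `O` lies in no matched pair. -/
theorem inc_eq_zero_of_not_mem {v : Fin h} (hv : v ∉ O) (W : Finset (Fin h)) : inc w α β v W = 0 := by
  unfold inc
  rw [Finset.card_eq_zero, Finset.filter_eq_empty_iff]
  rintro j - ⟨hvj | hvj, -⟩
  · exact hv (hvj ▸ hα j)
  · exact hv (hvj ▸ hβ j)

include hK in
/-- A set meeting `O` lies in no 3-column. -/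
theorem inc_eq_zero_of_mem {c : Fin h} (hcO : c ∈ O) {W : Finset (Fin h)} (hc : c ∈ W) (v : Fin h) :
    inc w α β v W = 0 := by
  unfold inc
  rw [Finset.card_eq_zero, Finset.filter_eq_empty_iff]
  rintro j - ⟨-, hWj⟩
  exact hK j c (hWj hc) hcO

include hK in
/-- `inc v {t} ≠ 0` forces `t ∉ O`. -/
theorem not_mem_of_inc_single_ne_zero {v t : Fin h} (ht : inc w α β v {t} ≠ 0) : t ∉ O := fun htO =>
  ht (inc_eq_zero_of_mem w O α β hK htO (Finset.mem_singleton_self t) v)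

include hα hβ hK in
/-- The weighted product `inc b {t} · coeff (E ∅ W) (rr t · rr a)` at a 3-column `W ⊆ Oᶜ`, for `a ∈ O`:
`−2 · inc b {t} · [t ∈ W] · inc a (W ∖ t)`. -/
theorem inc_mul_coeff_rr_mul_rr_three (a b t : Fin h) (W : Finset (Fin h)) (hW : W.card = 3) :
    (inc w α β b {t} : ℂ) * coeff (∑ a' ∈ (∅ : Finset (Fin h)), Finsupp.single (Fin.castAdd h a') 1 +
        ∑ c ∈ W, Finsupp.single (Fin.natAdd h c) 1) (rr w α β t * rr w α β a) =
      -2 * (inc w α β b {t} : ℂ) * (if t ∈ W then (inc w α β a (W.erase t) : ℂ) else 0) := by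
  by_cases htO : t ∈ O
  · rw [inc_eq_zero_of_mem w O α β hK htO (Finset.mem_singleton_self t) b]; simp
  rw [coeff_rr_mul_rr_three w α β t a W hW]
  have hterm : ∀ c ∈ W, (2 * (inc w α β t (W.erase c) : ℂ) * -((if c = a then 1 else 0) + (inc w α β a {c} : ℂ)) +
        -((if c = t then 1 else 0) + (inc w α β t {c} : ℂ)) * (2 * (inc w α β a (W.erase c) : ℂ))) =
      if c = t then -2 * (inc w α β a (W.erase t) : ℂ) else 0 := by
    intro c hc
    rw [inc_eq_zero_of_not_mem w O α β hα hβ htO, inc_eq_zero_of_not_mem w O α β hα hβ htO]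
    by_cases hct : c = t
    · subst hct; simp
    · rw [if_neg hct, if_neg hct]; simp
  rw [Finset.sum_congr rfl hterm, Finset.sum_ite_eq' W t]
  split_ifs <;> ring

include hα hβ hK in
/-- **THE CANCELLATION (memo §3 STEP 3): the non-edge row of `j` at a 3-column `W = w j'` is `24 [j' = j]`.** -/
theorem coeff_pNE_triple (hw : Function.Injective w) (j j' : {j : Fin r // (w j).card = 3}) :
    coeff (∑ a' ∈ (∅ : Finset (Fin h)), Finsupp.single (Fin.castAdd h a') 1 +
        ∑ c ∈ w j'.1, Finsupp.single (Fin.natAdd h c) 1)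
        (rr w α β (α j) * rr w α β (β j) + corrNE w α β j) = if j' = j then 24 else 0 := by
  set W := w j'.1 with hWdef
  have hW : W.card = 3 := j'.2
  have hWO : ∀ c ∈ W, c ∉ O := hK j'
  unfold corrNE
  rw [coeff_add, coeff_sub, coeff_sub, coeff_pivotTerm w j W (by omega), coeff_rr_mul_rr_three w α β _ _ W hW,
    coeff_sum, coeff_sum, if_neg (by rintro h0; rw [h0] at hW; simp at hW), if_neg (show ¬ W.card = 1 by omega),
    if_neg (show ¬ W.card = 2 by omega)]
  simp_rw [coeff_C_mul]
  rw [Finset.sum_congr rfl (fun t _ => inc_mul_coeff_rr_mul_rr_three w O α β hα hβ hK (α j) (β j) t W hW),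
    Finset.sum_congr rfl (fun t _ => inc_mul_coeff_rr_mul_rr_three w O α β hα hβ hK (β j) (α j) t W hW)]
  -- the two weighted sums are sums over `t ∈ W`
  have hsumW : ∀ (f : Fin h → ℂ), ∑ t, -2 * f t * (if t ∈ W then (inc w α β (α j) (W.erase t) : ℂ) else 0) =
      ∑ t ∈ W, -2 * f t * (inc w α β (α j) (W.erase t) : ℂ) := by
    intro f
    rw [← Finset.sum_filter_add_sum_filter_not Finset.univ (fun t => t ∈ W)]
    rw [Finset.sum_eq_zero (s := Finset.univ.filter (fun t => ¬ t ∈ W)) (fun t ht => by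
      rw [if_neg (Finset.mem_filter.mp ht).2, mul_zero]), add_zero]
    have hf : Finset.univ.filter (fun t => t ∈ W) = W := by ext t; simp
    rw [hf]
    exact Finset.sum_congr rfl fun t ht => by rw [if_pos ht]
  have hsumW' : ∀ (f : Fin h → ℂ), ∑ t, -2 * f t * (if t ∈ W then (inc w α β (β j) (W.erase t) : ℂ) else 0) =
      ∑ t ∈ W, -2 * f t * (inc w α β (β j) (W.erase t) : ℂ) := by
    intro f
    rw [← Finset.sum_filter_add_sum_filter_not Finset.univ (fun t => t ∈ W)]
    rw [Finset.sum_eq_zero (s := Finset.univ.filter (fun t => ¬ t ∈ W)) (fun t ht => by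
      rw [if_neg (Finset.mem_filter.mp ht).2, mul_zero]), add_zero]
    have hf : Finset.univ.filter (fun t => t ∈ W) = W := by ext t; simp
    rw [hf]
    exact Finset.sum_congr rfl fun t ht => by rw [if_pos ht]
  rw [hsumW (fun t => (inc w α β (β j) {t} : ℂ)), hsumW' (fun t => (inc w α β (α j) {t} : ℂ))]
  -- the main product: `[c = β j] = [c = α j] = 0` on `W`
  have hmain : ∀ c ∈ W, (2 * (inc w α β (α j) (W.erase c) : ℂ) * -((if c = β j then 1 else 0) + (inc w α β (β j) {c} : ℂ)) +
        -((if c = α j then 1 else 0) + (inc w α β (α j) {c} : ℂ)) * (2 * (inc w α β (β j) (W.erase c) : ℂ))) =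
      -2 * (inc w α β (α j) (W.erase c) : ℂ) * (inc w α β (β j) {c} : ℂ) -
        2 * (inc w α β (α j) {c} : ℂ) * (inc w α β (β j) (W.erase c) : ℂ) := by
    intro c hc
    rw [if_neg (fun e => hWO c hc (by rw [e]; exact hβ j)), if_neg (fun e => hWO c hc (by rw [e]; exact hα j))]
    ring
  rw [Finset.sum_congr rfl hmain]
  -- `[W ⊆ w j] ↔ j' = j`
  have hsub : (if W ⊆ w j.1 then (1 : ℂ) else 0) = if j' = j then 1 else 0 := by
    by_cases hjj : j' = j
    · rw [if_pos hjj, if_pos (by rw [hWdef, hjj])]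
    · rw [if_neg hjj, if_neg]
      intro hsub
      apply hjj
      have heq : W = w j.1 := Finset.eq_of_subset_of_card_le hsub (by rw [hW, j.2])
      exact Subtype.ext (hw heq)
  rw [hsub]
  have hcancel : (∑ c ∈ W, (-2 * (inc w α β (α j) (W.erase c) : ℂ) * (inc w α β (β j) {c} : ℂ) -
        2 * (inc w α β (α j) {c} : ℂ) * (inc w α β (β j) (W.erase c) : ℂ))) -
      (∑ t ∈ W, -2 * (inc w α β (β j) {t} : ℂ) * (inc w α β (α j) (W.erase t) : ℂ)) -
      (∑ t ∈ W, -2 * (inc w α β (α j) {t} : ℂ) * (inc w α β (β j) (W.erase t) : ℂ)) = 0 := by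
    rw [← Finset.sum_sub_distrib, ← Finset.sum_sub_distrib]
    exact Finset.sum_eq_zero fun c _ => by ring
  split_ifs <;> linear_combination hcancel

end Starved

end

end Summit.ValiantsHypothesis.ValiantsHypothesis.Theorems.BarrierLever.ChowStarvedDesign
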